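import Summits.QuantumFields.BalabanUV.T4Continuum.Spine.NE9.DirectPairingPropagationCarriers
import Summits.QuantumFields.BalabanUV.T4Continuum.Spine.NE9.DirectPairingUniformCarriers

/-!
# T⁴ programme, spine estimate NE9 — THE C^∞ BRANCH: King's run-uniform step clauses [UC-OLD] ∕ [UC-LAST] from RUN-UNIFORM FIRST-DERIVATIVE
# BOUNDS (mean-value inequality on a convex set, REAL Banach spaces — no holomorphy, no margin), and both consumers' ENDs BY NAME; what is
# load-bearing on either branch is a VOLUME-UNIFORM QUANTITATIVE bound of printed KIND — census item C37e of cell `pub-balaban-gaps`, seat ne9 (gen 9)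

Cell `pub-balaban-gaps` (YM blitz G2, seat ne9, unit `pub-balaban-gaps-ne9-g9`; record `run/shared/lean/pub/pub-balaban-gaps/ne/NE9.md` §5
row C37e).  Summits-side bookkeeping; real analysis on hypothesis SHAPES; NO definition; nothing of Bałaban's asserted.

CONTEXT.  C37 (`DirectPairingMargin`) discharged the run-uniform step clauses of King's currency from HOLOMORPHY on a uniform complex thickening + a
run-uniform bound (Cauchy), i.e. on print's «(or analytic)» branch ([Balaban1987RG1] p. 263, p. 266).  Print's MAIN branch is C^∞: p. 263 L25–26
*"It is a C^∞-function of g_{j−1} ∈ [0, γ], (or analytic)"* (for `E^{(j)}`), p. 264 L25–26 *"It is a smooth function defined on the interval [0, γ],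
(or analytic), uniformly bounded on this interval together with all derivatives"* (for `β_j`).  This file records the C^∞-branch twin: a
RUN-UNIFORM bound on the FIRST derivative (in the last coupling on the convex coupling range; Fréchet in the old data on a convex set containing the
class) gives the same run-uniform Lipschitz moduli by the mean-value inequality — in REAL Banach spaces, with no complex structure, no margin and no
completeness.  On either branch the load-bearing item is the same: a VOLUME-UNIFORM QUANTITATIVE bound (complex sup-bound with margin, or real
derivative bound); per-run smoothness alone is not enough (`DirectPairingMargin.sinFamily_not_uniformLast`: `sin(n·c)` is entire and its derivative
at `0` is `n`, `sinFamily_hasDerivAt_zero` below).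

WHAT IS PROVED (0 sorry).
* §1 `lipschitzLast_of_derivBound` ∕ `uniformLast_of_derivBound`: `I` convex; per level ONE `M₁` such that for every run `s` and class element `w`
  the map `c ↦ Φ s j c w` has a derivative within `I` bounded by `M₁` ⇒ `‖Φ s j c w − Φ s j c' w‖ ≤ M₁|c − c'|` ⇒ the `hlast` binder of
  `DirectPairingPropagation.propagate` VERBATIM (Mathlib `Convex.norm_image_sub_le_of_norm_hasDerivWithin_le`).
  `lipschitzOld_of_fderivBound` ∕ `uniformOld_of_fderivBound`: per level a convex `K j ⊇ A j` and ONE `L₁` such that for every run and last coupling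
  `Φ s j c` has a Fréchet derivative within `K j` bounded by `L₁` ⇒ Lipschitz `L₁` on the class ⇒ the `hold` binder VERBATIM
  (`Convex.norm_image_sub_le_of_norm_hasFDerivWithin_le`).
* §2 `king_U6_of_derivBounds` (node U3 → U6, `DirectPairingPropagationCarriers.king_U6_of_propagation` BY NAME) and
  `uniformSmall_carriers_of_derivBounds` (node U5b, `DirectPairingUniformCarriers.uniformSmall_carriers` ∘ `prefix_carriers_of_markov` ∘
  `sepUC_carriers_of_propagation` BY NAME): both consumers of NE9 from tower-NE5 + the Markov recursion + run-uniform first-derivative bounds +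
  uniformly continuous read-outs.
* §3 `sinFamily_hasDerivAt_zero`: the derivative of `c ↦ sin(n·c)` at `0` is `n` — the run family of `DirectPairingMargin` §4 has no run-uniform
  derivative bound, matching the failure of its run-uniform modulus.

HONEST FRAMING: bookkeeping for rung (B)+1 on ONE FIXED finite four-torus; analysis on hypothesis SHAPES; run-uniform derivative bounds for Bałaban's
step are H∃ readings of printed KIND ([I] pp. 263–264; volume-uniformity = Thm 1 p. 259 *"uniform in the lattice spacing"*) about the ONE-STEP object
(W1, instance 0∕1), NOT PRINTED as theorems for `E^{(j)}`'s derivatives ∕ NOT PROVED; tower-NE5 = the cell's NE5 (NOT PRINTED, NOT PROVED); NE9 NOT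
PRINTED ∕ NOT PROVED; spine 0∕9; NOT continuum ∕ ℝ⁴ ∕ mass gap ∕ Clay.  CLASSIFICATION OF NE9 UNCHANGED: WORK-bound (W1).

References (TYPES only): [Balaban1987RG1] = T. Bałaban, Commun. Math. Phys. **109** (1987) 249–301, p. 256, Thm 1 p. 259, p. 263 L22–28, p. 264
L25–26; [King1986] = C. King, Commun. Math. Phys. **102** (1986) 649–677, §3.2.
-/

namespace Summit.QuantumFields.BalabanUV.T4Continuum.NE9.DirectPairingMarginSmooth

open scoped BigOperators
open Filter Topology Metric Set
open Literature.MathematicalPhysics.QuantumFieldTheory.Balaban1983to89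
open Literature.MathematicalPhysics.QuantumFieldTheory.Balaban1983to89.T4CouplingAnalyticity (BoxWindow)
open T4CauchySum (delta)
open Summit.QuantumFields.BalabanUV.T4Continuum.NE9.TowerCarriers
open Summit.QuantumFields.BalabanUV.T4Continuum.NE9.TowerCarriersBox (TowerNE5On)
open Summit.QuantumFields.BalabanUV.T4Continuum.NE9.DirectPairingPropagationCarriers
  (prefix_carriers_of_markov sepUC_carriers_of_propagation king_U6_of_propagation)
open Summit.QuantumFields.BalabanUV.T4Continuum.NE9.DirectPairingUniformCarriers (uniformSmall_carriers)

variable {F : Type*} [NormedAddCommGroup F] [NormedSpace ℝ F]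

/-! ## §1 Run-uniform first-derivative bounds ⇒ the run-uniform step clauses (mean-value inequality) -/

section Step

variable {σ : Type*} {Φ : σ → ℕ → ℝ → F → F} {A : ℕ → Set F} {I : Set ℝ}

/-- **RUN-UNIFORM DERIVATIVE BOUND IN THE LAST COUPLING ⇒ RUN-UNIFORM LIPSCHITZ**: on a convex coupling range `I`, per level ONE bound `M₁` on the
derivative (within `I`) of `c ↦ Φ s j c w` for every run `s` and class element `w` gives `‖Φ s j c w − Φ s j c' w‖ ≤ M₁|c − c'|`. [folklore] -/
theorem lipschitzLast_of_derivBound (hI : Convex ℝ I) {Φ' : σ → ℕ → ℝ → F → F}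
    (hD : ∀ j, ∃ M₁ : ℝ, ∀ s, ∀ w ∈ A j, (∀ c ∈ I, HasDerivWithinAt (fun c => Φ s j c w) (Φ' s j c w) I c) ∧
      ∀ c ∈ I, ‖Φ' s j c w‖ ≤ M₁) (j : ℕ) :
    ∃ L : ℝ, 0 ≤ L ∧ ∀ s, ∀ w ∈ A j, ∀ c ∈ I, ∀ c' ∈ I, ‖Φ s j c w - Φ s j c' w‖ ≤ L * |c - c'| := by
  obtain ⟨M₁, h⟩ := hD j
  refine ⟨max M₁ 0, le_max_right _ _, fun s w hw c hc c' hc' => ?_⟩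
  obtain ⟨hder, hbd⟩ := h s w hw
  have key := hI.norm_image_sub_le_of_norm_hasDerivWithin_le hder hbd hc' hc
  rw [Real.norm_eq_abs] at key
  exact key.trans (mul_le_mul_of_nonneg_right (le_max_left _ _) (abs_nonneg _))

/-- **… ⇒ [UC-LAST] RUN-UNIFORMLY** — the `hlast` binder of `DirectPairingPropagation.propagate` VERBATIM, on print's C^∞ branch. [folklore] -/
theorem uniformLast_of_derivBound (hI : Convex ℝ I) {Φ' : σ → ℕ → ℝ → F → F}
    (hD : ∀ j, ∃ M₁ : ℝ, ∀ s, ∀ w ∈ A j, (∀ c ∈ I, HasDerivWithinAt (fun c => Φ s j c w) (Φ' s j c w) I c) ∧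
      ∀ c ∈ I, ‖Φ' s j c w‖ ≤ M₁) :
    ∀ j, ∀ ε : ℝ, 0 < ε → ∃ δ : ℝ, 0 < δ ∧ ∀ s, ∀ w ∈ A j, ∀ c ∈ I, ∀ c' ∈ I,
      |c - c'| ≤ δ → dist (Φ s j c w) (Φ s j c' w) ≤ ε := by
  intro j ε hε
  obtain ⟨L, hL0, hL⟩ := lipschitzLast_of_derivBound hI hD j
  have hL1 : 0 < L + 1 := by linarith
  refine ⟨ε / (L + 1), div_pos hε hL1, fun s w hw c hc c' hc' hd => ?_⟩
  rw [dist_eq_norm]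
  calc ‖Φ s j c w - Φ s j c' w‖ ≤ L * |c - c'| := hL s w hw c hc c' hc'
    _ ≤ (L + 1) * |c - c'| := mul_le_mul_of_nonneg_right (by linarith) (abs_nonneg _)
    _ ≤ (L + 1) * (ε / (L + 1)) := mul_le_mul_of_nonneg_left hd hL1.le
    _ = ε := mul_div_cancel₀ ε hL1.ne'

/-- **RUN-UNIFORM FRÉCHET-DERIVATIVE BOUND IN THE OLD DATA ⇒ RUN-UNIFORM LIPSCHITZ ON THE CLASS**: per level a convex `K j ⊇ A j` (e.g. the
(1.18)-ball itself) and ONE bound `L₁` on the Fréchet derivative (within `K j`) of `Φ s j c` for every run `s` and last coupling `c` gives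
`‖Φ s j c w − Φ s j c w'‖ ≤ L₁‖w − w'‖` on the class — in a REAL normed space, no holomorphy. [folklore] -/
theorem lipschitzOld_of_fderivBound {K : ℕ → Set F} (hK : ∀ j, Convex ℝ (K j)) (hAK : ∀ j, A j ⊆ K j)
    {Φ' : σ → ℕ → ℝ → F → (F →L[ℝ] F)}
    (hD : ∀ j, ∃ L₁ : ℝ, ∀ s, ∀ c ∈ I, (∀ w ∈ K j, HasFDerivWithinAt (Φ s j c) (Φ' s j c w) (K j) w) ∧
      ∀ w ∈ K j, ‖Φ' s j c w‖ ≤ L₁) (j : ℕ) :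
    ∃ L : ℝ, 0 ≤ L ∧ ∀ s, ∀ c ∈ I, ∀ w ∈ A j, ∀ w' ∈ A j, ‖Φ s j c w - Φ s j c w'‖ ≤ L * ‖w - w'‖ := by
  obtain ⟨L₁, h⟩ := hD j
  refine ⟨max L₁ 0, le_max_right _ _, fun s c hc w hw w' hw' => ?_⟩
  obtain ⟨hder, hbd⟩ := h s c hc
  have key := (hK j).norm_image_sub_le_of_norm_hasFDerivWithin_le hder hbd (hAK j hw') (hAK j hw)
  exact key.trans (mul_le_mul_of_nonneg_right (le_max_left _ _) (norm_nonneg _))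

/-- **… ⇒ [UC-OLD] RUN-UNIFORMLY** — the `hold` binder of `DirectPairingPropagation.propagate` VERBATIM, on print's C^∞ branch. [folklore] -/
theorem uniformOld_of_fderivBound {K : ℕ → Set F} (hK : ∀ j, Convex ℝ (K j)) (hAK : ∀ j, A j ⊆ K j)
    {Φ' : σ → ℕ → ℝ → F → (F →L[ℝ] F)}
    (hD : ∀ j, ∃ L₁ : ℝ, ∀ s, ∀ c ∈ I, (∀ w ∈ K j, HasFDerivWithinAt (Φ s j c) (Φ' s j c w) (K j) w) ∧
      ∀ w ∈ K j, ‖Φ' s j c w‖ ≤ L₁) :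
    ∀ j, ∀ ε : ℝ, 0 < ε → ∃ δ : ℝ, 0 < δ ∧ ∀ s, ∀ c ∈ I, ∀ w ∈ A j, ∀ w' ∈ A j,
      dist w w' ≤ δ → dist (Φ s j c w) (Φ s j c w') ≤ ε := by
  intro j ε hε
  obtain ⟨L, hL0, hL⟩ := lipschitzOld_of_fderivBound hK hAK hD j
  have hL1 : 0 < L + 1 := by linarith
  refine ⟨ε / (L + 1), div_pos hε hL1, fun s c hc w hw w' hw' hd => ?_⟩
  rw [dist_eq_norm] at hd ⊢
  calc ‖Φ s j c w - Φ s j c w'‖ ≤ L * ‖w - w'‖ := hL s c hc w hw w' hw'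
    _ ≤ (L + 1) * ‖w - w'‖ := mul_le_mul_of_nonneg_right (by linarith) (norm_nonneg _)
    _ ≤ (L + 1) * (ε / (L + 1)) := mul_le_mul_of_nonneg_left hd hL1.le
    _ = ε := mul_div_cancel₀ ε hL1.ne'

end Step

/-! ## §2 Both consumers' ENDs BY NAME on the C^∞ branch -/

section Ends

variable (T : TowerData) {E : ℕ → (ℕ → ℝ) → T.B → T.Dom → ℝ} {I : Set ℝ} {κ : ℝ}
  {V : ℕ → ℕ → (ℕ → ℝ) → F} {Φ : ℕ → ℕ → ℝ → F → F} {A K : ℕ → Set F} {ev : ℕ → T.B → T.Dom → F → ℝ}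
  {Φc : ℕ → ℕ → ℝ → F → F} {Φw : ℕ → ℕ → ℝ → F → (F →L[ℝ] F)}

/-- **NODE U6 IN KING'S CURRENCY ON THE C^∞ BRANCH** (`DirectPairingPropagationCarriers.king_U6_of_propagation` BY NAME): tower-NE5 + one Markov
recursion per run + run-uniform FIRST-DERIVATIVE bounds (last coupling on the convex range `I`; old data on convex `K j ⊇ A j`) + uniformly
continuous read-outs + the (1.18)-type bound + node U2's summable profile ⇒ the scale profile `b_j → 0` and `T4CauchySum.delta → 0`. [folklore] -/
theorem king_U6_of_derivBounds {θ C₅ B : ℝ} {p : ℕ → ℝ} {t : ℕ → ℕ → ℝ}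
    (hC : 0 ≤ C₅) (hθ0 : 0 ≤ θ) (hθ1 : θ < 1) (h5 : TowerNE5On T E I κ θ C₅) (hI : Convex ℝ I)
    (h0 : ∀ k, ∀ g ∈ BoxWindow I, ∀ g' ∈ BoxWindow I, V k 0 g = V k 0 g')
    (hrec : ∀ k j, ∀ g ∈ BoxWindow I, V k (j + 1) g = Φ k j (g j) (V k j g))
    (hmem : ∀ k m, ∀ g ∈ BoxWindow I, V k m g ∈ A m)
    (hK : ∀ j, Convex ℝ (K j)) (hAK : ∀ j, A j ⊆ K j)
    (hDw : ∀ j, ∃ L₁ : ℝ, ∀ k, ∀ c ∈ I, (∀ w ∈ K j, HasFDerivWithinAt (Φ k j c) (Φw k j c w) (K j) w) ∧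
      ∀ w ∈ K j, ‖Φw k j c w‖ ≤ L₁)
    (hDc : ∀ j, ∃ M₁ : ℝ, ∀ k, ∀ w ∈ A j, (∀ c ∈ I, HasDerivWithinAt (fun c => Φ k j c w) (Φc k j c w) I c) ∧
      ∀ c ∈ I, ‖Φc k j c w‖ ≤ M₁)
    (hev : ∀ m, ∀ ε : ℝ, 0 < ε → ∃ δ : ℝ, 0 < δ ∧ ∀ (k : ℕ) (U : T.B) (X : T.Dom), T.r X + m = k →
      ∀ w ∈ A m, ∀ w' ∈ A m, dist w w' ≤ δ → Real.exp (κ * T.d X) * |ev k U X w - ev k U X w'| ≤ ε)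
    (hE : ∀ (k : ℕ) (U : T.B) (X : T.Dom), ∀ g ∈ BoxWindow I, E k g U X = ev k U X (V k (k - T.r X) g))
    (hB0 : 0 ≤ B) (hB : ∀ (k : ℕ) (U : T.B) (X : T.Dom), ∀ g ∈ BoxWindow I, Real.exp (κ * T.d X) * |E k g U X| ≤ B)
    (ht : ∀ K, t K ∈ BoxWindow I) (hp : ∀ K i, |t (K + 1) (i + 1) - t K i| ≤ p i) (hp0 : ∀ i, 0 ≤ p i) (hps : Summable p) :
    ∃ b : ℕ → ℝ, (∀ j, 0 ≤ b j) ∧ Tendsto b atTop (𝓝 0) ∧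
      (∀ (K n : ℕ) (U : T.B) (X : T.Dom), T.r X ≤ K →
        |E (K + n) (t (K + n)) U X - E K (t K) (T.descend (K + n) U K) X| ≤ b (K - T.r X) * Real.exp (-(κ * T.d X))) ∧
      ∀ (E₀ ρ : ℝ) (inj : ℕ → ℕ → ℝ), 0 ≤ E₀ → 0 ≤ ρ → ρ < 1 →
        (∀ K j : ℕ, j ≤ K → 0 ≤ inj K j ∧ inj K j ≤ b j) → Tendsto (delta E₀ ρ inj) atTop (𝓝 0) :=
  king_U6_of_propagation T hC hθ0 hθ1 h5 h0 hrec hmem (uniformOld_of_fderivBound hK hAK hDw) (uniformLast_of_derivBound hI hDc)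
    hev hE hB0 hB ht hp hp0 hps

/-- **NODE U5b ON THE C^∞ BRANCH** (`DirectPairingUniformCarriers.uniformSmall_carriers` ∘ `prefix_carriers_of_markov` ∘ `sepUC_carriers_of_propagation`
BY NAME): the same E-side list ⇒ ∀ η > 0 ∃ δ > 0, δ-close admissible histories below the scale give `η·e^{−κd(X)}`-close terms, uniformly in run ∕
scale ∕ background ∕ domain.  No fading memory, no moduli `Λ`. [folklore] -/
theorem uniformSmall_carriers_of_derivBounds {θ C₅ : ℝ} (hC : 0 ≤ C₅) (hθ0 : 0 ≤ θ) (hθ1 : θ < 1)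
    (h5 : TowerNE5On T E I κ θ C₅) (hI : Convex ℝ I)
    (h0 : ∀ k, ∀ g ∈ BoxWindow I, ∀ g' ∈ BoxWindow I, V k 0 g = V k 0 g')
    (hrec : ∀ k j, ∀ g ∈ BoxWindow I, V k (j + 1) g = Φ k j (g j) (V k j g))
    (hmem : ∀ k m, ∀ g ∈ BoxWindow I, V k m g ∈ A m)
    (hK : ∀ j, Convex ℝ (K j)) (hAK : ∀ j, A j ⊆ K j)
    (hDw : ∀ j, ∃ L₁ : ℝ, ∀ k, ∀ c ∈ I, (∀ w ∈ K j, HasFDerivWithinAt (Φ k j c) (Φw k j c w) (K j) w) ∧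
      ∀ w ∈ K j, ‖Φw k j c w‖ ≤ L₁)
    (hDc : ∀ j, ∃ M₁ : ℝ, ∀ k, ∀ w ∈ A j, (∀ c ∈ I, HasDerivWithinAt (fun c => Φ k j c w) (Φc k j c w) I c) ∧
      ∀ c ∈ I, ‖Φc k j c w‖ ≤ M₁)
    (hev : ∀ m, ∀ ε : ℝ, 0 < ε → ∃ δ : ℝ, 0 < δ ∧ ∀ (k : ℕ) (U : T.B) (X : T.Dom), T.r X + m = k →
      ∀ w ∈ A m, ∀ w' ∈ A m, dist w w' ≤ δ → Real.exp (κ * T.d X) * |ev k U X w - ev k U X w'| ≤ ε)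
    (hE : ∀ (k : ℕ) (U : T.B) (X : T.Dom), ∀ g ∈ BoxWindow I, E k g U X = ev k U X (V k (k - T.r X) g))
    {η : ℝ} (hη : 0 < η) :
    ∃ δ : ℝ, 0 < δ ∧ ∀ (k : ℕ) (U : T.B) (X : T.Dom), T.r X ≤ k →
      ∀ g ∈ BoxWindow I, ∀ g' ∈ BoxWindow I, (∀ i, i < k - T.r X → |g i - g' i| ≤ δ) →
        |E k g U X - E k g' U X| ≤ η * Real.exp (-(κ * T.d X)) :=
  uniformSmall_carriers T hC hθ0 hθ1 h5 (prefix_carriers_of_markov T h0 hrec hE)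
    (sepUC_carriers_of_propagation T h0 hrec hmem (uniformOld_of_fderivBound hK hAK hDw) (uniformLast_of_derivBound hI hDc)
      hev hE) hη

end Ends

/-! ## §3 Two-sidedness pointer: per-run smoothness without a run-uniform derivative bound -/

/-- The run family `c ↦ sin(n·c)` of `DirectPairingMargin` §4 — per-run smooth, with NO run-uniform modulus (`sinFamily_not_uniformLast`) — has
derivative `n` at `c = 0`: no run-uniform first-derivative bound, as §1 requires. [folklore] -/
theorem sinFamily_hasDerivAt_zero (n : ℕ) : HasDerivAt (fun c : ℝ => Real.sin (n * c)) (n : ℝ) 0 := by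
  have h1 : HasDerivAt (fun c : ℝ => (n : ℝ) * c) (n : ℝ) 0 := by
    simpa using (hasDerivAt_id (0 : ℝ)).const_mul (n : ℝ)
  have h2 : HasDerivAt (fun c : ℝ => Real.sin ((n : ℝ) * c)) (Real.cos ((n : ℝ) * 0) * n) 0 := h1.sin
  simpa using h2

end Summit.QuantumFields.BalabanUV.T4Continuum.NE9.DirectPairingMarginSmooth
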